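import Mathlib
import Summits.MatrixMultiplication.MatrixMultiplication.Theorems.HiddenToeplitzCornersHiddenCornerLemmaRStein
import Summits.MatrixMultiplication.MatrixMultiplication.Theorems.HiddenToeplitzCornersHiddenCornerLemmaRStubDualityAnnihilator

/-!
# Strip matrices: rows of a Stein inverse with standard-basis generators (wave 3, package F)

Support file for crux item `stmt-MatrixMultiplication-10752`
(`Summit.MatrixMultiplication.MatrixMultiplication.Theses.HiddenToeplitzCorners.HiddenCornerLemmaR`),
line `frobenius-dual-short-syzygies`, stub `stub_gconstDualLaw` / the strip theorem
(paper proof `math/STRIP_THEOREM.md` §3, steps (S-a) and (II)).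

Notation (written out verbatim in every statement): `Z` is the lower shift on `ℂ^N`
(`Z i j = [i = j + 1]`), so `(Z *ᵥ v) i = v (i - 1)` and `(Zᵀ *ᵥ v) i = v (i + 1)`;
`G₀ i k = [i = c k]` is the `N × p` matrix whose column `k` is the standard basis vector at row
`c k` (the zero column if `c k ≥ N`).  A *strip matrix* is an `M` with Stein displacement
`M − Z M Zᵀ = G₀ Hᵀ`.

Results (registered helper stubs of the crux):
* `hclR_strip_mulVec` (F2): `(M *ᵥ y) i = Σ_k [c k ≤ i] · η_k ⬝ᵥ ((Zᵀ)^(i − c k) *ᵥ y)` with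
  `η_k = (H · k)` the `k`-th column of `H` — row `c k + m` of `M` is the functional
  `y ↦ Σ ⟨η_k, (Zᵀ)^m y⟩`;
* `hclR_strip_entry` (F1): `M i j = Σ_k [c k ≤ i] · (Z^(i − c k) *ᵥ η_k) j` (F2 at `y = e_j`);
* `hclR_rows_annihilating_le` (F3): if `det M ≠ 0` and the rows of `M` indexed by `I` annihilate a
  subspace `W` (for the dot product), then `card I + finrank W ≤ N`.

Proofs.  F2: general Stein inversion `M = Σ_{m<N} Z^m (G₀ Hᵀ) (Zᵀ)^m`
(`hclR_eq_stein_sum_general`), then `(Z^m G₀ Hᵀ (Zᵀ)^m y) i = [m ≤ i] Σ_k [i − m = c k] η_k ⬝ᵥ (Zᵀ)^m y`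
(`hclR_strip_term_mulVec`) and the sum over `m` collapses to `m = i − c k`.  F1 is F2 at a
standard basis vector.  F3: the map `Φ : ℂ^N → Dual W`, `v ↦ (w ↦ v ⬝ᵥ w)`, is surjective
(`dotProductEquiv`, `Subspace.dualRestrict_surjective`), so `finrank (ker Φ) = N − finrank W` by
rank–nullity, and the rows `M i`, `i ∈ I`, are linearly independent
(`Matrix.linearIndependent_rows_of_det_ne_zero`) inside `ker Φ`.  Folklore.
-/

set_option linter.dupNamespace false

namespace Summit.MatrixMultiplication.MatrixMultiplication.Theorems

open scoped Matrix BigOperators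
open Summit.MatrixMultiplication.MatrixMultiplication.Cruxes.HiddenCornerLemmaR.FrobeniusDualShortSyzygies
  (hclR_eq_stein_sum_general)

/-! ## Helpers -/

/-- Multiplying by `G₀ = ([i = c k])_{i,k}` on the left places entry `k` of a vector at row `c k`:
`(G₀ *ᵥ x) n = Σ_k [n = c k] x k`. -/
theorem hclR_strip_gen_mulVec {N p : ℕ} (c : Fin p → ℕ) (x : Fin p → ℂ) (n : Fin N) :
    ((Matrix.of fun (i : Fin N) (k : Fin p) => if (i : ℕ) = c k then (1 : ℂ) else 0) *ᵥ x) n =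
      ∑ k : Fin p, if (n : ℕ) = c k then x k else 0 := by
  rw [Matrix.mulVec, dotProduct]
  refine Finset.sum_congr rfl fun k _ => ?_
  rw [Matrix.of_apply]
  split_ifs <;> simp

/-- Entry `k` of `Hᵀ *ᵥ w` is the dot product of column `k` of `H` with `w`. -/
theorem hclR_strip_transpose_mulVec {N p : ℕ} (H : Matrix (Fin N) (Fin p) ℂ) (w : Fin N → ℂ)
    (k : Fin p) : (Hᵀ *ᵥ w) k = (fun n => H n k) ⬝ᵥ w := by
  rw [Matrix.mulVec_transpose, Matrix.vecMul, dotProduct_comm]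

/-- One term of the Stein sum of a strip matrix applied to a vector:
`(Z^m (G₀ Hᵀ) (Zᵀ)^m *ᵥ y) i = Σ_k [m ≤ i ∧ i − m = c k] · η_k ⬝ᵥ ((Zᵀ)^m *ᵥ y)`. -/
theorem hclR_strip_term_mulVec {N p : ℕ} (c : Fin p → ℕ) (H : Matrix (Fin N) (Fin p) ℂ)
    (y : Fin N → ℂ) (m : ℕ) (i : Fin N) :
    (((Matrix.of fun i j : Fin N => if (i : ℕ) = (j : ℕ) + 1 then (1 : ℂ) else 0) ^ m *
        ((Matrix.of fun (i : Fin N) (k : Fin p) => if (i : ℕ) = c k then (1 : ℂ) else 0) * Hᵀ) *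
        ((Matrix.of fun i j : Fin N => if (i : ℕ) = (j : ℕ) + 1 then (1 : ℂ) else 0)ᵀ) ^ m) *ᵥ y) i =
      ∑ k : Fin p, if m ≤ (i : ℕ) ∧ (i : ℕ) - m = c k then
        (fun n => H n k) ⬝ᵥ
          (((Matrix.of fun i j : Fin N => if (i : ℕ) = (j : ℕ) + 1 then (1 : ℂ) else 0)ᵀ) ^ m *ᵥ y)
        else 0 := by
  rw [← Matrix.mulVec_mulVec, ← Matrix.mulVec_mulVec, hclR_shift_pow_mulVec]
  by_cases h : m ≤ (i : ℕ)
  · rw [dif_pos h, ← Matrix.mulVec_mulVec, hclR_strip_gen_mulVec]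
    refine Finset.sum_congr rfl fun k _ => ?_
    by_cases hk : (i : ℕ) - m = c k
    · rw [if_pos hk, if_pos ⟨h, hk⟩, hclR_strip_transpose_mulVec]
    · rw [if_neg hk, if_neg fun h' => hk h'.2]
  · rw [dif_neg h]
    exact (Finset.sum_eq_zero fun k _ => if_neg fun h' => h h'.1).symm

/-! ## F2 — the row functionals of a strip matrix -/

set_option linter.unusedVariables false in
/-- **F2** (row functionals of a strip matrix).  If `M − Z M Zᵀ = G₀ Hᵀ` with `G₀ i k = [i = c k]`,
then for every vector `y` and every row index `i`,
`(M *ᵥ y) i = Σ_k [c k ≤ i] · η_k ⬝ᵥ ((Zᵀ)^(i − c k) *ᵥ y)`, `η_k` the `k`-th column of `H`.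
Proof: Stein inversion `M = Σ_{m<N} Z^m G₀ Hᵀ (Zᵀ)^m`, the term formula `hclR_strip_term_mulVec`,
and the sum over `m` collapses to the single index `m = i − c k`. -/
theorem hclR_strip_mulVec : ∀ (N p : ℕ) (c : Fin p → ℕ) (M : Matrix (Fin N) (Fin N) ℂ) (H : Matrix (Fin N) (Fin p) ℂ) (hM : M - (Matrix.of fun i j : Fin (N) => if (i : ℕ) = (j : ℕ) + 1 then (1 : ℂ) else 0) * M * ((Matrix.of fun i j : Fin (N) => if (i : ℕ) = (j : ℕ) + 1 then (1 : ℂ) else 0))ᵀ = (Matrix.of fun (i : Fin N) (k : Fin p) => if (i : ℕ) = c k then (1 : ℂ) else 0) * Hᵀ) (y : Fin N → ℂ) (i : Fin N), (M *ᵥ y) i = ∑ k : Fin p, if c k ≤ (i : ℕ) then (fun n => H n k) ⬝ᵥ ((((Matrix.of fun i j : Fin (N) => if (i : ℕ) = (j : ℕ) + 1 then (1 : ℂ) else 0))ᵀ) ^ ((i : ℕ) - c k) *ᵥ y) else 0 := by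
  intro N p c M H hM y i
  rw [hclR_eq_stein_sum_general M _ hM, Matrix.sum_mulVec, Finset.sum_apply,
    Finset.sum_congr rfl fun m _ => hclR_strip_term_mulVec c H y m i, Finset.sum_comm]
  refine Finset.sum_congr rfl fun k _ => ?_
  by_cases hk : c k ≤ (i : ℕ)
  · rw [if_pos hk, Finset.sum_eq_single ((i : ℕ) - c k)]
    · rw [if_pos ⟨Nat.sub_le _ _, Nat.sub_sub_self hk⟩]
    · intro m _ hm
      exact if_neg fun h' => hm (by omega)
    · intro h
      exact absurd (Finset.mem_range.mpr (by have := i.2; omega)) h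
  · rw [if_neg hk]
    exact Finset.sum_eq_zero fun m _ => if_neg fun h' => hk (by omega)

/-! ## F1 — the entries of a strip matrix -/

set_option linter.unusedVariables false in
/-- **F1** (Stein inversion for a strip displacement).  If `M − Z M Zᵀ = G₀ Hᵀ` with
`G₀ i k = [i = c k]` (the generators are standard basis vectors at rows `c k`), then every row of
`M` is a sum of shifted generator rows: `M i j = Σ_k [c k ≤ i] · (Z^(i − c k) *ᵥ η_k) j`,
`η_k` the `k`-th column of `H`.  This is F2 at the basis vector `y = e_j`, using
`η ⬝ᵥ ((Zᵀ)^a *ᵥ e_j) = (Z^a *ᵥ η) j`. -/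
theorem hclR_strip_entry : ∀ (N p : ℕ) (c : Fin p → ℕ) (M : Matrix (Fin N) (Fin N) ℂ) (H : Matrix (Fin N) (Fin p) ℂ) (hM : M - (Matrix.of fun i j : Fin (N) => if (i : ℕ) = (j : ℕ) + 1 then (1 : ℂ) else 0) * M * ((Matrix.of fun i j : Fin (N) => if (i : ℕ) = (j : ℕ) + 1 then (1 : ℂ) else 0))ᵀ = (Matrix.of fun (i : Fin N) (k : Fin p) => if (i : ℕ) = c k then (1 : ℂ) else 0) * Hᵀ) (i j : Fin N), M i j = ∑ k : Fin p, if c k ≤ (i : ℕ) then (((Matrix.of fun i j : Fin (N) => if (i : ℕ) = (j : ℕ) + 1 then (1 : ℂ) else 0)) ^ ((i : ℕ) - c k) *ᵥ (fun n => H n k)) j else 0 := by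
  intro N p c M H hM i j
  have h := hclR_strip_mulVec N p c M H hM (Pi.single j 1) i
  rw [Matrix.mulVec_single_one, Matrix.col_apply] at h
  rw [h]
  refine Finset.sum_congr rfl fun k _ => ?_
  split_ifs
  · rw [Matrix.dotProduct_mulVec, dotProduct_single_one, ← Matrix.transpose_pow,
      Matrix.vecMul_transpose]
  · rfl

/-! ## F3 — annihilating rows of an invertible matrix are few -/

set_option linter.unusedVariables false in
/-- **F3** (counting annihilating rows).  If `det M ≠ 0` and the rows of `M` indexed by `I` all
annihilate a subspace `W ≤ ℂ^N` for the dot product (`M i ⬝ᵥ w = 0` for `i ∈ I`, `w ∈ W`), then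
`card I + finrank W ≤ N`.  Proof: `Φ : ℂ^N → Dual W`, `v ↦ (w ↦ v ⬝ᵥ w)`, is surjective (the dot
product identifies `ℂ^N` with its dual and restriction `Dual ℂ^N → Dual W` is onto), so
`finrank (ker Φ) + finrank W = N`; the rows `M i`, `i ∈ I`, are linearly independent (as `M` is
invertible) and lie in `ker Φ`, so `card I ≤ finrank (ker Φ)`. -/
theorem hclR_rows_annihilating_le : ∀ (N : ℕ) (M : Matrix (Fin N) (Fin N) ℂ) (hM : M.det ≠ 0) (W : Submodule ℂ (Fin N → ℂ)) (I : Finset (Fin N)) (hI : ∀ i ∈ I, ∀ w ∈ W, M i ⬝ᵥ w = 0), I.card + Module.finrank ℂ W ≤ N := by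
  intro N M hM W I hI
  classical
  -- the annihilating-functional map `Φ v = (w ↦ v ⬝ᵥ w)|_W`
  set Φ : (Fin N → ℂ) →ₗ[ℂ] Module.Dual ℂ W :=
    W.dualRestrict ∘ₗ (dotProductEquiv ℂ (Fin N)).toLinearMap with hΦ
  have hsurj : Function.Surjective Φ :=
    Subspace.dualRestrict_surjective.comp (dotProductEquiv ℂ (Fin N)).surjective
  -- rank–nullity: `finrank W + finrank (ker Φ) = N`
  have hrank : Module.finrank ℂ W + Module.finrank ℂ (LinearMap.ker Φ) = N := by
    have h := LinearMap.finrank_range_add_finrank_ker Φ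
    rwa [LinearMap.range_eq_top.mpr hsurj, finrank_top, Subspace.dual_finrank_eq,
      Module.finrank_fin_fun] at h
  -- the rows indexed by `I` lie in `ker Φ`
  have hmem : ∀ i ∈ I, M i ∈ LinearMap.ker Φ := by
    intro i hi
    rw [LinearMap.mem_ker]
    ext w
    rw [hΦ, LinearMap.comp_apply, Submodule.dualRestrict_apply, LinearMap.zero_apply]
    exact hI i hi w w.2
  -- and they are linearly independent
  have hli : LinearIndependent ℂ (fun i : I => M (i : Fin N)) :=
    (Matrix.linearIndependent_rows_of_det_ne_zero hM).comp ((↑) : I → Fin N)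
      Subtype.val_injective
  have hcard : I.card ≤ Module.finrank ℂ (LinearMap.ker Φ) := by
    have h1 := finrank_span_eq_card hli
    rw [Fintype.card_coe] at h1
    have h2 : Submodule.span ℂ (Set.range fun i : I => M (i : Fin N)) ≤ LinearMap.ker Φ := by
      rw [Submodule.span_le]
      rintro _ ⟨i, rfl⟩
      exact hmem i i.2
    have h3 := Submodule.finrank_mono h2
    omega
  omega

end Summit.MatrixMultiplication.MatrixMultiplication.Theorems
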